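import Summits.QuantumFields.BalabanUV.Beta.EriceRemainderEnclosureHistoryAnalytic
import Summits.QuantumFields.BalabanUV.Beta.EriceRemainderEnclosureHistoryAnalyticWalsh
import Summits.QuantumFields.BalabanUV.Beta.EriceRemainderEnclosureHistoryTwoLoopSharp

/-!
# EriceRemainderEnclosureHistoryAnalyticSharp — (E31c) END: ANALYTICITY IN ALL THE COUPLINGS IS NOT MEMORY — one history family,
# ENTIRE and bounded by `R³` on every polydisc at every scale, with the printed split, (AF-1) and binder (D4)'s junction, whose EVERY
# history-Lipschitz modulus has total weight `≥ γ²·√(k+1)∕6`: no `k`-uniform total weight, no fading memory; and (E30b)'s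
# polynomial family as the entire witness that the two-loop VALUE is not paid either

Cell `pub-balaban`, β-function sub-cell, BINDER row D4 «RemainderConst leaves for Bałaban's split» (`HOME/BINDER-OWNERS.md`; owner
lineage `b2b-balaban-beta-an4`; this file by co-owner #2 lineage `b2b-balaban-beta-d4-p2`, generation 33), β-FLOW TEAM duty (1)
under the rulings «YM REDIRECT» (FREEZE (0) honoured: def-free module in the lineage's `EriceRemainderEnclosure*` series, no new leaf)
and «YM ACCELERATION» item (2).  Third file of station (E31): `…HistoryAnalytic` (positive dictionary: weights = complex amplitudes)
and `…HistoryAnalyticWalsh` (the Walsh–Hadamard block functional at one level) are imported and composed BY NAME.  THE QUESTION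
(census sense (α)): [Balaban1987RG1] p. 266 tl. 33–37 *«the functions E^{(j)}, β_j are analytic functions of the effective
coupling constants»* — does this sentence, in its STRONGEST joint reading (entire in all `k + 1` couplings, ONE bound on every
polydisc, uniform in the scale and in the number of variables) together with (AF-1), supply the located HISTORY inputs of the
β-column: (D4-J2)'s summable modulus (`Σ_{i≤k} Λ k i ≤ C_Λ`), node U2's `FadingMemory C θ Λ` (two-run matching, NE4), (E30)'s first
moment ∕ road P3's log-moment (two-loop law)?  ANSWER: NO, none of them.

HONEST FRAMING (page 1 of everything the β sub-cell writes).  *"Discharging BetaPertH makes Bałaban's UV stability UNCONDITIONAL —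
a real constructive-QFT result; it is NOT the continuum limit and NOT the Clay problem."*  THIS FILE DISCHARGES NOTHING OF THE
KIND.  It exhibits TEST OBJECTS for the typed hypothesis shapes (`FlowStep.HBeta`, `B12Beta.OneLoopSplit`, `Beta.RemainderChain.
RemainderConst`, `T4CouplingMatching.HistLipschitz` ∕ `FadingMemory`) — explicit polynomials, NOT models of [I] (1.22); nothing of
Bałaban's β-functions is asserted, constructed or instantiated; every located input stays NOT-IN-PRINT (p. 266 qualitative; GAPS
G-t4-U2-2); row D4 class UNCHANGED (critical-path width 0; instance 0∕1; D4 DISCHARGE NO DATE); NOT B12 Thm 2, NOT BetaPertH, NOT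
continuum, NOT Clay.  HONEST DEPENDENCY: continuum YM on T⁴ ⇐ BetaPertH ∧ nine spine estimates (0/9 proved); BetaPertH ⇐ (D1) ∧ (D4)
∧ CAP+tail; G-an2-4 gates asym, D1 and NE2/3/4.  ABSOLUTE RULE: nothing is cited as a fact; every statement is proved about the shapes.

WHAT IS PROVED ([folklore]; 0 sorry; 0 `def`).  §1 `weight_nonneg` (every weight of a history-Lipschitz bound on a box is `≥ 0`),
`sumWeights_ge` (the Walsh functional: `Σ_i Λ_i ≥ c·γ²·n²∕4`), **`level_witness_exists`** (level `k ≥ 1`: entire, `‖F‖ ≤ R³`,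
vanishing at `p_k = 0`, `|f| ≤ γ₀²·p_k`, and `Σ_i Λ_i ≥ γ²·√(k+1)∕6` for every weight vector — block `2^m ≤ k < 2^{m+1}`).  §2 END
**`analyticAllCouplings_not_memory`**: ONE `β : HBeta` with (a) entire, `R³`-bounded extensions at every scale, (b) a printed split with
`β⁰ ≡ 0`, (AF-1) `|β¹| ≤ γ₀²·p_k` and `RemainderConst S γ (γ³)` for every `γ > 0` (binder (D4)'s junction), (b′) (D4-J2)'s
off-diagonal oscillation `≤ 2γ³` on ]0,γ]^{k+1} — (OSC) WITHOUT a summable modulus, (c) `Σ_{i≤k} Λ k i ≥ γ²·√(k+1)∕6` for EVERY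
`HistLipschitz Λ γ β`, `k ≥ 1`, hence (d) no `C_Λ` and (e) `¬ FadingMemory C θ Λ` for all `C`, `0 ≤ θ < 1` ((D4-J2)
`sumWeights_le_of_fadingMemory` BY NAME); `histLipschitz_add_const_iff` (adding a one-loop constant `b_k` changes no modulus: the
shifted family is positive and bounded below with the same absent moduli).  §3 **`holoAll_not_sufficient_for_value`**: (E30b)'s family `1 + p_k(p_k − p_0)`
is ENTIRE with `‖F‖ ≤ 1 + 2R²` on polydiscs AND ((E30b) `family_boundedWeight_not_sufficient` BY NAME) carries `HistLipschitz`
with bounded total weight, a two-loop-free diagonal, yet NO `K`-uniform two-loop bound with the diagonal's coefficient: joint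
analyticity does not pay the two-loop VALUE either.  READING: on the analytic road the memory inputs are AMPLITUDE-DECAY statements
(`…HistoryAnalytic.histLipschitz_of_coordOsc`), independent of analyticity and of (AF-1) — in [I] they would transcribe the
irrelevance of the old terms ((0.29) p. 258), which print states for the terms V^{(j)}(X, U_k) of (0.28) (summing to
−β_j A^η + E^{(j)}), not for β.
-/

noncomputable section

open Finset Metric Set

namespace Summit.QuantumFields.BalabanUV.Beta.EriceRemainderEnclosureHistoryAnalyticSharp

open Literature.MathematicalPhysics.QuantumFieldTheory.Balaban1983to89
open Literature.MathematicalPhysics.QuantumFieldTheory.Balaban1983to89.FlowStep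
open Literature.MathematicalPhysics.QuantumFieldTheory.Balaban1983to89.T4CouplingMatching
open Literature.MathematicalPhysics.QuantumFieldTheory.Balaban1983to89.Beta.RemainderChain (RemainderConst)
open Literature.MathematicalPhysics.QuantumFieldTheory.Balaban1983to89.T4TwoLoopLaw (twoLoopConst)
open Summit.QuantumFields.BalabanUV.Beta.EriceRemainderEnclosureHistoryAnalyticWalsh

/-! ## §1 From the block weights to the total weight, and the level-`k` witness -/

section Witness

variable {X : Type*} [Fintype X] [DecidableEq X] {H : X → X → ℝ} {k : ℕ} {e : X → Fin (k + 1)} {c : ℝ}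
  {f : (Fin (k + 1) → ℝ) → ℝ}

omit [Fintype X] [DecidableEq X] in
/-- Every weight of a history-Lipschitz bound on a box is nonnegative (compare a history with the one obtained by lowering
one coordinate). [folklore] -/
theorem weight_nonneg {γ : ℝ} (hγ : 0 < γ) {Λ : Fin (k + 1) → ℝ} {g : (Fin (k + 1) → ℝ) → ℝ}
    (hΛ : ∀ p q, p ∈ Box γ k → q ∈ Box γ k → |g p - g q| ≤ ∑ i, Λ i * |p i - q i|) (i : Fin (k + 1)) :
    0 ≤ Λ i := by
  set q : Fin (k + 1) → ℝ := fun _ => γ with hq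
  set p : Fin (k + 1) → ℝ := Function.update q i (γ / 2) with hp
  have hqB : q ∈ Box γ k := mem_box.2 fun _ => ⟨hγ, le_rfl⟩
  have hpB : p ∈ Box γ k := mem_box.2 fun j => by
    rw [hp, Function.update_apply]
    split_ifs
    · exact ⟨by linarith, by linarith⟩
    · exact ⟨hγ, le_rfl⟩
  have h := (abs_nonneg _).trans (hΛ p q hpB hqB)
  have hsum : ∑ j, Λ j * |p j - q j| = Λ i * (γ / 2) := by
    have : ∀ j, Λ j * |p j - q j| = if j = i then Λ i * (γ / 2) else 0 := by
      intro j
      rw [hp, Function.update_apply]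
      split_ifs with hji
      · subst hji
        rw [hq]
        rw [show γ / 2 - γ = -(γ / 2) by ring, abs_neg, abs_of_pos (by linarith)]
      · simp [hq]
    simp_rw [this]
    rw [sum_ite_eq', if_pos (Finset.mem_univ _)]
  rw [hsum] at h
  nlinarith

/-- **NO `k`-UNIFORM TOTAL WEIGHT.**  Summing `blockWeight_ge` over the block (injectivity of `e`; all weights are nonnegative by
`weight_nonneg`): `Σ_i Λ i ≥ c·γ²·n²∕4` — with `c = 1∕(n√n)`, `≥ γ²·√n∕4`. [folklore] -/
theorem sumWeights_ge (hsym : ∀ x y, H x y = H y x)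
    (horth : ∀ x x', ∑ y, H x y * H x' y = if x = x' then (Fintype.card X : ℝ) else 0)
    (hone : ∀ x y, H x y = 1 ∨ H x y = -1) {x₀ : X} (hrow : ∀ y, H x₀ y = 1)
    (he : Function.Injective e) (hlast : ∀ x, e x ≠ Fin.last k)
    (hf : ∀ p, f p = p (Fin.last k) * (c * ∑ x, p (e x) * ∑ y, H x y * p (e y))) (hc : 0 ≤ c)
    {γ : ℝ} (hγ : 0 < γ) {Λ : Fin (k + 1) → ℝ}
    (hΛ : ∀ p q, p ∈ Box γ k → q ∈ Box γ k → |f p - f q| ≤ ∑ i, Λ i * |p i - q i|) :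
    c * γ ^ 2 * (Fintype.card X : ℝ) ^ 2 / 4 ≤ ∑ i, Λ i := by
  have hblock : ∀ a, c * γ ^ 2 * (Fintype.card X : ℝ) / 4 ≤ Λ (e a) :=
    blockWeight_ge hsym horth hone hrow he hlast hf hc hγ hΛ
  calc c * γ ^ 2 * (Fintype.card X : ℝ) ^ 2 / 4 = ∑ _a : X, c * γ ^ 2 * (Fintype.card X : ℝ) / 4 := by
        rw [sum_const, card_univ, nsmul_eq_mul]; ring
    _ ≤ ∑ a, Λ (e a) := sum_le_sum fun a _ => hblock a
    _ = ∑ i ∈ univ.image e, Λ i := (sum_image fun x _ y _ h => he h).symm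
    _ ≤ ∑ i, Λ i := sum_le_sum_of_subset_of_nonneg (subset_univ _) fun i _ _ => weight_nonneg hγ hΛ i

end Witness

/-! ## §2 END: one history family, entire and uniformly bounded in ALL its couplings, (AF-1), junction — and NO summable modulus -/

/-- **LEVEL `k ≥ 1`.**  There is a history functional `f : (Fin (k+1) → ℝ) → ℝ` which (i) is the restriction of an ENTIRE function
of the `k + 1` complex couplings bounded by `R³` on every polydisc `‖z_i‖ ≤ R` (constant independent of `k`), (ii) vanishes when the
last coupling does and satisfies the (AF-1) shape `|f p| ≤ γ₀²·p_k` on every box ]0,γ₀]^{k+1}, and (iii) admits NO small history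
modulus: every weight vector `Λ` with `|f p − f q| ≤ Σ_i Λ_i |p_i − q_i|` on ]0,γ]^{k+1} has `Σ_i Λ_i ≥ γ²·√(k+1)∕6`.  Witness: the
Walsh–Hadamard quadratic form of the first `2^m ≤ k < 2^{m+1}` couplings times the last one, normalised by `n^{−3∕2}`. [folklore] -/
theorem level_witness_exists (k : ℕ) (hk : 1 ≤ k) :
    ∃ f : (Fin (k + 1) → ℝ) → ℝ,
      (∃ F : (Fin (k + 1) → ℂ) → ℂ, Differentiable ℂ F ∧
        (∀ (R : ℝ) (z : Fin (k + 1) → ℂ), (∀ i, ‖z i‖ ≤ R) → ‖F z‖ ≤ R ^ 3) ∧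
        ∀ p : Fin (k + 1) → ℝ, F (fun i => (p i : ℂ)) = ((f p : ℝ) : ℂ)) ∧
      (∀ p : Fin (k + 1) → ℝ, p (Fin.last k) = 0 → f p = 0) ∧
      (∀ (γ₀ : ℝ) (p : Fin (k + 1) → ℝ), p ∈ Box γ₀ k → |f p| ≤ γ₀ ^ 2 * p (Fin.last k)) ∧
      ∀ (γ : ℝ), 0 < γ → ∀ Λ : Fin (k + 1) → ℝ,
        (∀ p q, p ∈ Box γ k → q ∈ Box γ k → |f p - f q| ≤ ∑ i, Λ i * |p i - q i|) →
        γ ^ 2 * Real.sqrt ((k : ℝ) + 1) / 6 ≤ ∑ i, Λ i := by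
  -- the block `X = Fin m → Bool`, `n = 2^m`, `n ≤ k < 2n`
  set m : ℕ := Nat.log 2 k with hm
  have hnk : 2 ^ m ≤ k := Nat.pow_log_le_self 2 (by omega)
  have hkn : k < 2 ^ (m + 1) := Nat.lt_pow_succ_log_self (by norm_num) k
  have hcard : Fintype.card (Fin m → Bool) = 2 ^ m := by
    rw [Fintype.card_fun, Fintype.card_bool, Fintype.card_fin]
  have hn1 : 1 ≤ Fintype.card (Fin m → Bool) := by rw [hcard]; exact Nat.one_le_two_pow
  have h2n_nat : k + 1 ≤ 2 * Fintype.card (Fin m → Bool) := by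
    rw [hcard]; rw [pow_succ] at hkn; omega
  obtain ⟨n, hn⟩ : ∃ n : ℕ, Fintype.card (Fin m → Bool) = n := ⟨_, rfl⟩
  rw [hn] at hn1 h2n_nat
  have hnR : (1 : ℝ) ≤ n := by exact_mod_cast hn1
  have hnpos : (0 : ℝ) < n := by linarith
  have hsqpos : 0 < Real.sqrt n := Real.sqrt_pos.2 hnpos
  have h2n : (k : ℝ) + 1 ≤ 2 * n := by exact_mod_cast h2n_nat
  -- the injection of the block below the last coordinate
  set e : (Fin m → Bool) → Fin (k + 1) := fun x =>
    ⟨(Fintype.equivFin (Fin m → Bool) x : ℕ), ((Fintype.equivFin _ x).isLt.trans_le (hcard.le.trans hnk)).trans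
      (Nat.lt_succ_self k)⟩ with he_def
  have he : Function.Injective e := by
    intro x y h
    have hv : ((Fintype.equivFin (Fin m → Bool) x : ℕ)) = (Fintype.equivFin (Fin m → Bool) y : ℕ) := by
      have := congrArg Fin.val h
      simpa [he_def] using this
    exact (Fintype.equivFin _).injective (Fin.ext hv)
  have hlast : ∀ x, e x ≠ Fin.last k := by
    intro x h
    have hv := congrArg Fin.val h
    simp only [he_def, Fin.val_last] at hv
    have := (Fintype.equivFin (Fin m → Bool) x).isLt
    omega
  -- the Walsh kernel and its Hadamard properties
  set H : (Fin m → Bool) → (Fin m → Bool) → ℝ := fun x y => ∏ i, if (x i && y i) = true then (-1 : ℝ) else 1 with hH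
  have hsym : ∀ x y, H x y = H y x := fun x y => walsh_sym m x y
  have horth : ∀ x x', ∑ y, H x y * H x' y = if x = x' then (Fintype.card (Fin m → Bool) : ℝ) else 0 :=
    fun x x' => walsh_orth m x x'
  have hone : ∀ x y, H x y = 1 ∨ H x y = -1 := fun x y => walsh_one m x y
  have hrow : ∀ y, H (fun _ => false) y = 1 := fun y => walsh_row0 m y
  -- the normalisation `c = 1∕(n√n)`
  set c : ℝ := 1 / ((n : ℝ) * Real.sqrt n) with hc_def
  have hc : 0 ≤ c := by positivity
  have hcn : c * (Real.sqrt n * (n : ℝ)) = 1 := by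
    rw [hc_def]; field_simp
  -- the witness
  refine ⟨fun p => p (Fin.last k) * (c * ∑ x, p (e x) * ∑ y, H x y * p (e y)), ?_, ?_, ?_, ?_⟩
  · refine ⟨fun z => z (Fin.last k) * ((c : ℂ) * ∑ x, z (e x) * ∑ y, (H x y : ℂ) * z (e y)),
      witness_differentiable H e c, fun R z hz => ?_, fun p => witness_ofReal (fun _ => rfl) p⟩
    calc ‖z (Fin.last k) * ((c : ℂ) * ∑ x, z (e x) * ∑ y, (H x y : ℂ) * z (e y))‖
        ≤ R * (c * (Real.sqrt (Fintype.card (Fin m → Bool)) * ((Fintype.card (Fin m → Bool) : ℝ) * R ^ 2))) :=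
          witness_norm_le hsym horth e hc z hz
      _ = R ^ 3 * (c * (Real.sqrt n * (n : ℝ))) := by rw [hn]; ring
      _ = R ^ 3 := by rw [hcn, mul_one]
  · intro p hp
    simp only [hp, zero_mul]
  · intro γ₀ p hp
    calc |p (Fin.last k) * (c * ∑ x, p (e x) * ∑ y, H x y * p (e y))|
        ≤ c * (Real.sqrt (Fintype.card (Fin m → Bool)) * ((Fintype.card (Fin m → Bool) : ℝ) * γ₀ ^ 2)) * p (Fin.last k) :=
          witness_abs_le hsym horth (fun _ => rfl) hc hp
      _ = γ₀ ^ 2 * p (Fin.last k) * (c * (Real.sqrt n * (n : ℝ))) := by rw [hn]; ring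
      _ = γ₀ ^ 2 * p (Fin.last k) := by rw [hcn, mul_one]
  · intro γ hγ Λ hΛ
    have h := sumWeights_ge hsym horth hone hrow he hlast (fun _ => rfl) hc hγ hΛ
    have hcn2 : c * γ ^ 2 * (n : ℝ) ^ 2 / 4 = γ ^ 2 * Real.sqrt n / 4 := by
      have hsq : Real.sqrt n * Real.sqrt n = n := Real.mul_self_sqrt hnpos.le
      rw [hc_def]
      field_simp
      nlinarith [hsq]
    rw [hn] at h
    rw [hcn2] at h
    have hsqrt : Real.sqrt ((k : ℝ) + 1) ≤ 3 / 2 * Real.sqrt n := by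
      calc Real.sqrt ((k : ℝ) + 1) ≤ Real.sqrt (2 * n) := Real.sqrt_le_sqrt h2n
        _ = Real.sqrt 2 * Real.sqrt n := Real.sqrt_mul (by norm_num) _
        _ ≤ 3 / 2 * Real.sqrt n := by
            refine mul_le_mul_of_nonneg_right ?_ (Real.sqrt_nonneg _)
            rw [Real.sqrt_le_left (by norm_num)]; norm_num
    nlinarith [sq_nonneg γ, mul_le_mul_of_nonneg_left hsqrt (sq_nonneg γ)]

/-- **END — ANALYTICITY IN ALL THE COUPLINGS IS NOT MEMORY.**  There is ONE history family `β : HBeta` such that: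
(a) at every scale `β_{k+1}` is the restriction to real histories of an ENTIRE function of its `k + 1` complex couplings, bounded by
`R³` on the polydisc `‖z_i‖ ≤ R` for EVERY `R` — the strongest form of [Balaban1987RG1] p. 266 tl. 33–37 «the functions E^{(j)}, β_j
are analytic functions of the effective coupling constants», with ONE pair (radius, bound) uniform in the scale AND in the number of
variables; (b) it carries the printed one-loop split with `β⁰ ≡ 0` and the (AF-1) shape `|β¹_{k+1}(p)| ≤ γ₀²·p_k` on every box — hence
binder (D4)'s junction with `r = γ³`, and (D4-J2)'s off-diagonal oscillation `≤ 2γ³` — (OSC) with NO summable weights behind it;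
and yet (c) EVERY history-Lipschitz modulus `Λ` of `β` on any box ]0,γ]^{k+1}
(`T4CouplingMatching.HistLipschitz Λ γ β`, node U2's currency) has total weight `Σ_{i≤k} Λ k i ≥ γ²·√(k+1)∕6`, so (d) no `k`-uniform
bound on the total weight exists and (e) `Λ` has NO fading memory (`¬ FadingMemory C θ Λ` for every `C` and `θ < 1`).  Reading: a
summable history modulus — the located input of (D4-J2)'s history half, of (E30)'s two-loop law (first moment) and of node U2's
two-run matching — is NOT a consequence of analyticity plus (AF-1); it is an INDEPENDENT input (in [I] it would come from the
irrelevance of the old terms, (0.29) p. 258, not from Cauchy estimates). [cite: Balaban1987RG1, §2 p.266 tl.33–37, §1 p.264, §5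
p.298, (0.29) p.258 — shapes only, nothing asserted] -/
theorem analyticAllCouplings_not_memory :
    ∃ β : HBeta,
      (∀ k, ∃ F : (Fin (k + 1) → ℂ) → ℂ, Differentiable ℂ F ∧
        (∀ (R : ℝ) (z : Fin (k + 1) → ℂ), (∀ i, ‖z i‖ ≤ R) → ‖F z‖ ≤ R ^ 3) ∧
        ∀ p : Fin (k + 1) → ℝ, F (fun i => (p i : ℂ)) = ((β k p : ℝ) : ℂ)) ∧
      (∃ S : B12Beta.OneLoopSplit β, (∀ k, S.β0 k = 0) ∧
        (∀ (γ₀ : ℝ) (k : ℕ) (p : Fin (k + 1) → ℝ), p ∈ B12Beta.HistBox γ₀ k →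
          |S.β1 k p| ≤ γ₀ ^ 2 * p (Fin.last k)) ∧
        ∀ γ : ℝ, 0 < γ → RemainderConst S γ (γ ^ 3)) ∧
      (∀ (γ : ℝ) (k : ℕ) (p : Fin (k + 1) → ℝ), p ∈ B12Beta.HistBox γ k →
        |β k p - β k (fun _ : Fin (k + 1) => p (Fin.last k))| ≤ 2 * γ ^ 3) ∧
      (∀ (γ : ℝ), 0 < γ → ∀ Λ : ℕ → ℕ → ℝ, HistLipschitz Λ γ β →
        ∀ k : ℕ, 1 ≤ k → γ ^ 2 * Real.sqrt ((k : ℝ) + 1) / 6 ≤ ∑ i : Fin (k + 1), Λ k i) ∧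
      (∀ (γ : ℝ), 0 < γ → ∀ Λ : ℕ → ℕ → ℝ, HistLipschitz Λ γ β →
        ¬ ∃ CΛ : ℝ, ∀ k : ℕ, ∑ i : Fin (k + 1), Λ k i ≤ CΛ) ∧
      ∀ (γ : ℝ), 0 < γ → ∀ Λ : ℕ → ℕ → ℝ, HistLipschitz Λ γ β →
        ∀ (C θ : ℝ), 0 ≤ θ → θ < 1 → ¬ FadingMemory C θ Λ := by
  -- level by level (level 0: the zero functional)
  have hlev : ∀ k : ℕ, ∃ f : (Fin (k + 1) → ℝ) → ℝ,
      (∃ F : (Fin (k + 1) → ℂ) → ℂ, Differentiable ℂ F ∧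
        (∀ (R : ℝ) (z : Fin (k + 1) → ℂ), (∀ i, ‖z i‖ ≤ R) → ‖F z‖ ≤ R ^ 3) ∧
        ∀ p : Fin (k + 1) → ℝ, F (fun i => (p i : ℂ)) = ((f p : ℝ) : ℂ)) ∧
      (∀ p : Fin (k + 1) → ℝ, p (Fin.last k) = 0 → f p = 0) ∧
      (∀ (γ₀ : ℝ) (p : Fin (k + 1) → ℝ), p ∈ Box γ₀ k → |f p| ≤ γ₀ ^ 2 * p (Fin.last k)) ∧
      (1 ≤ k → ∀ (γ : ℝ), 0 < γ → ∀ Λ : Fin (k + 1) → ℝ,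
        (∀ p q, p ∈ Box γ k → q ∈ Box γ k → |f p - f q| ≤ ∑ i, Λ i * |p i - q i|) →
        γ ^ 2 * Real.sqrt ((k : ℝ) + 1) / 6 ≤ ∑ i, Λ i) := by
    intro k
    rcases Nat.eq_zero_or_pos k with rfl | hk
    · refine ⟨fun _ => 0, ⟨fun _ => 0, differentiable_const _, fun R z hz => ?_, fun p => by simp⟩,
        fun _ _ => rfl, fun γ₀ p hp => ?_, fun h => absurd h (by norm_num)⟩
      · have hR : 0 ≤ R := (norm_nonneg _).trans (hz 0)
        simpa using pow_nonneg hR 3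
      · have := (mem_box.1 hp (Fin.last 0)).1
        rw [abs_zero]; positivity
    · obtain ⟨f, h1, h2, h3, h4⟩ := level_witness_exists k hk
      exact ⟨f, h1, h2, h3, fun _ => h4⟩
  choose f hF hvan hAF hW using hlev
  -- the split with β⁰ ≡ 0
  let S : B12Beta.OneLoopSplit (fun k => f k) :=
    { β0 := fun _ => 0
      β1 := fun k p => f k p
      split := fun k p => by simp
      vanish := fun k p hp => hvan k p hp }
  have hW' : ∀ (γ : ℝ), 0 < γ → ∀ Λ : ℕ → ℕ → ℝ, HistLipschitz Λ γ (fun k => f k) →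
      ∀ k : ℕ, 1 ≤ k → γ ^ 2 * Real.sqrt ((k : ℝ) + 1) / 6 ≤ ∑ i : Fin (k + 1), Λ k i :=
    fun γ hγ Λ hL k hk => hW k hk γ hγ (fun i => Λ k i) fun p q hp hq => hL k p q hp hq
  have hnoC : ∀ (γ : ℝ), 0 < γ → ∀ Λ : ℕ → ℕ → ℝ, HistLipschitz Λ γ (fun k => f k) →
      ¬ ∃ CΛ : ℝ, ∀ k : ℕ, ∑ i : Fin (k + 1), Λ k i ≤ CΛ := by
    rintro γ hγ Λ hL ⟨CΛ, hC⟩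
    obtain ⟨N, hN⟩ := exists_nat_gt ((6 * CΛ / γ ^ 2) ^ 2)
    have h := (hW' γ hγ Λ hL (N + 1) (by omega)).trans (hC (N + 1))
    have hγ2 : 0 < γ ^ 2 := by positivity
    have hs : Real.sqrt ((N : ℝ) + 1 + 1) ≤ 6 * CΛ / γ ^ 2 := by
      rw [le_div_iff₀ hγ2]; push_cast at h; linarith
    have hA : 0 ≤ 6 * CΛ / γ ^ 2 := (Real.sqrt_nonneg _).trans hs
    rw [Real.sqrt_le_left hA] at hs
    linarith
  have hcube : ∀ (γ : ℝ) (k : ℕ) (p : Fin (k + 1) → ℝ), p ∈ Box γ k → |f k p| ≤ γ ^ 3 := fun γ k p hp =>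
    calc |f k p| ≤ γ ^ 2 * p (Fin.last k) := hAF k γ p hp
      _ ≤ γ ^ 2 * γ := mul_le_mul_of_nonneg_left (mem_box.1 hp _).2 (sq_nonneg γ)
      _ = γ ^ 3 := by ring
  refine ⟨fun k => f k, hF, ⟨S, fun _ => rfl, fun γ₀ k p hp => ?_, fun γ _ k p hp => ?_⟩, fun γ k p hp => ?_, hW', hnoC,
    fun γ hγ Λ hL C θ hθ hθ1 hFad => hnoC γ hγ Λ hL ⟨C / (1 - θ),
      EriceRemainderEnclosureHistoryJunction.sumWeights_le_of_fadingMemory hFad hθ hθ1⟩⟩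
  · exact hAF k γ₀ p (by rwa [histBox_eq_box] at hp)
  · exact hcube γ k p (by rwa [histBox_eq_box] at hp)
  · have hp' : p ∈ Box γ k := by rwa [histBox_eq_box] at hp
    have hc' : (fun _ : Fin (k + 1) => p (Fin.last k)) ∈ Box γ k := mem_box.2 fun _ => mem_box.1 hp' _
    calc |f k p - f k (fun _ : Fin (k + 1) => p (Fin.last k))|
        ≤ |f k p| + |f k (fun _ : Fin (k + 1) => p (Fin.last k))| := abs_sub _ _
      _ ≤ γ ^ 3 + γ ^ 3 := add_le_add (hcube γ k p hp') (hcube γ k _ hc')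
      _ = 2 * γ ^ 3 := by ring

/-- **ADDING A ONE-LOOP CONSTANT CHANGES NO MODULUS.**  `HistLipschitz Λ γ β ↔ HistLipschitz Λ γ (b_k + β)` for any scale-dependent
constant `b` — so the END's family shifted by `b_k ≥ γ₀³ + b₀` (`b₀ > 0`) is POSITIVE and bounded below by `b₀` on ]0,γ₀]^{k+1} (the sign ∕
`EventualLowerH` binders of the column) with the SAME absent moduli: the no-go is not an artefact of `β⁰ ≡ 0`. [folklore] -/
theorem histLipschitz_add_const_iff {β : HBeta} (b : ℕ → ℝ) (Λ : ℕ → ℕ → ℝ) (γ : ℝ) :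
    HistLipschitz Λ γ (fun k p => b k + β k p) ↔ HistLipschitz Λ γ β := by
  constructor <;> intro h k p q hp hq <;> simpa [add_sub_add_left_eq_sub] using h k p q hp hq

/-! ## §3 Joint analyticity does not pay the two-loop VALUE either: (E30b)'s family is entire -/

/-- (E30b)'s family `β k p = b + c·p_k·(p_k − p_0)` is, at every scale, the restriction of an ENTIRE function of the `k + 1` complex
couplings bounded by `|b| + 2|c|R²` on the polydisc `‖z_i‖ ≤ R`. [folklore] -/
theorem e30bFamily_holoAll {β : HBeta} {b c : ℝ}
    (hβ : ∀ (k : ℕ) (p : Fin (k + 1) → ℝ), β k p = b + c * p (Fin.last k) * (p (Fin.last k) - p 0)) (k : ℕ) :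
    ∃ F : (Fin (k + 1) → ℂ) → ℂ, Differentiable ℂ F ∧
      (∀ (R : ℝ) (z : Fin (k + 1) → ℂ), (∀ i, ‖z i‖ ≤ R) → ‖F z‖ ≤ |b| + 2 * |c| * R ^ 2) ∧
      ∀ p : Fin (k + 1) → ℝ, F (fun i => (p i : ℂ)) = ((β k p : ℝ) : ℂ) := by
  refine ⟨fun z => (b : ℂ) + (c : ℂ) * z (Fin.last k) * (z (Fin.last k) - z 0), by fun_prop, fun R z hz => ?_,
    fun p => by rw [hβ k p]; push_cast; ring⟩
  have hR : 0 ≤ R := (norm_nonneg _).trans (hz 0)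
  calc ‖(b : ℂ) + (c : ℂ) * z (Fin.last k) * (z (Fin.last k) - z 0)‖
      ≤ ‖(b : ℂ)‖ + ‖(c : ℂ) * z (Fin.last k) * (z (Fin.last k) - z 0)‖ := norm_add_le _ _
    _ = |b| + |c| * ‖z (Fin.last k)‖ * ‖z (Fin.last k) - z 0‖ := by
        rw [norm_mul, norm_mul, Complex.norm_real, Complex.norm_real, Real.norm_eq_abs, Real.norm_eq_abs]
    _ ≤ |b| + |c| * R * (R + R) := by
        have h1 : ‖z (Fin.last k) - z 0‖ ≤ R + R := (norm_sub_le _ _).trans (add_le_add (hz _) (hz _))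
        gcongr
        exact hz _
    _ = |b| + 2 * |c| * R ^ 2 := by ring

/-- **JOINT ANALYTICITY DOES NOT PAY THE TWO-LOOP VALUE.**  (E30b)'s family with `b = c = 1`, `γ = 1∕2` is ENTIRE in all its
couplings with `‖F‖ ≤ 1 + 2R²` on every polydisc (`e30bFamily_holoAll`) AND — (E30b) `family_boundedWeight_not_sufficient` BY NAME —
carries node U2's `HistLipschitz` with a bounded two-point modulus, has a two-loop-free diagonal, and yet along the runs of (0.20)
ending at `g` NO `K`-uniform two-loop bound with the diagonal's coefficient `0` exists.  So even entire dependence on all the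
couplings with uniform bounds leaves the two-loop VALUE to the first ∕ log age-moment of (E30) ∕ road P3. [folklore] -/
theorem holoAll_not_sufficient_for_value {g : ℝ} (hg : 0 < g) (hgγ : g ≤ 1 / 2) :
    let βw : HBeta := fun k p => 1 + 1 * p (Fin.last k) * (p (Fin.last k) - p 0)
    (∀ k, ∃ F : (Fin (k + 1) → ℂ) → ℂ, Differentiable ℂ F ∧
        (∀ (R : ℝ) (z : Fin (k + 1) → ℂ), (∀ i, ‖z i‖ ≤ R) → ‖F z‖ ≤ 1 + 2 * R ^ 2) ∧
        ∀ p : Fin (k + 1) → ℝ, F (fun i => (p i : ℂ)) = ((βw k p : ℝ) : ℂ)) ∧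
      HistLipschitz (fun k i => if i = k then 3 * 1 * (1 / 2 : ℝ) else if i = 0 then 1 * (1 / 2 : ℝ) else 0) (1 / 2) βw ∧
      (∃ S : B12Beta.OneLoopSplit βw, (∀ k, S.β0 k = 1) ∧
        ∀ (k : ℕ) (x : ℝ), 0 < x → x ≤ 1 / 2 → |S.β1 k (fun _ : Fin (k + 1) => x) - 0 * x ^ 2| ≤ 0 * x ^ 3 + 0 * (0 : ℝ) ^ k) ∧
      ¬ ∃ Q' : ℝ, ∀ (K : ℕ) (gs : ℕ → ℝ), 0 < K → RGEqH K βw gs → (∀ k, k ≤ K → 0 < gs k ∧ gs k ≤ 1 / 2) →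
        gs K = g → |1 / (gs 0) ^ 2 - 1 / g ^ 2 - (K : ℝ) * 1| ≤ Q' := by
  intro βw
  have hβ : ∀ (k : ℕ) (p : Fin (k + 1) → ℝ), βw k p = 1 + 1 * p (Fin.last k) * (p (Fin.last k) - p 0) := fun _ _ => rfl
  obtain ⟨h1, h2, h3, h4⟩ := EriceRemainderEnclosureHistoryTwoLoopSharp.family_boundedWeight_not_sufficient hg hgγ
  refine ⟨fun k => ?_, h1, h3, h4⟩
  obtain ⟨F, hF, hFb, hFp⟩ := e30bFamily_holoAll hβ k
  exact ⟨F, hF, fun R z hz => (hFb R z hz).trans (by norm_num), hFp⟩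

end Summit.QuantumFields.BalabanUV.Beta.EriceRemainderEnclosureHistoryAnalyticSharp

end
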